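import Literature.Analysis.FluidPDE.CheskidovNoAnomalyAssembly
import Literature.Analysis.FluidPDE.PassiveScalarWellPosednessProofs
import Literature.Analysis.FluidPDE.QuasiSelfSimilarFamilyProofs
import Literature.Analysis.FluidPDE.QuasiSelfSimilarCompatibleBlocksProofs
import HarnessLib

/-!
# Cheskidov's no-dissipation-anomaly family from the Alberti–Crippa–Mazzucato blocks alone
(arXiv:2311.04182, §§3–4 with the viscosities (4.19), from Thm. 3.1)

Topic `Literature/Analysis/FluidPDE` (family `turb`). Theorem-only assembly file for the vendored
named fact `Literature.Analysis.FluidPDE.cheskidov_noAnomaly_family`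
(`CheskidovNoAnomalyFamily.lean`; Cheskidov 2023, §3 (3.2)–(3.13), Lemma 3.2 (3.16), §4 (4.2),
(4.3) with the "low" viscosities (4.19) `ν_m^l = m⁻¹λ_m⁻²`: the planar core of Thm. 2.1 with energy
level `e = 0`, behind the barrier
`Literature.Barriers.AnomalousDissipation.Cheskidov2023_thm21_noDissipationAnomaly`, which is proved
from it in `Literature/Barriers/AnomalousDissipation/AnomalousDissipationWithoutDissipationAnomalyProofs.lean`).
Its printed proof has two inputs:

1. the quasi-self-similar mixing family (Cheskidov 2023, Thm. 3.1 = Bruè–De Lellis 2023,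
   Thm. 4.1) — the named fact `Literature.Analysis.FluidPDE.alberti_crippa_mazzucato_family`
   (`QuasiSelfSimilarMixing.lean`, item (c) per level), NOT discharged, but proved in the tree
   from the structural fact `acm_building_blocks` (`QuasiSelfSimilarBuildingBlocks.lean`) by
   `alberti_crippa_mazzucato_family_of_building_blocks` (`QuasiSelfSimilarFamilyProofs.lean`),
   itself proved from the kinematic leaf `acm_compatible_blocks`
   (`QuasiSelfSimilarCompatibleBlocks.lean`: the two generating moves of the Peano snake with
   their gate structure, ACM 2019, §8.1, §8.4) by `acm_building_blocks_of_compatible_blocks`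
   (`QuasiSelfSimilarCompatibleBlocksProofs.lean`);
2. classical parabolic well-posedness of (4.2) on `T²` (§4 p. 12, "let `θ^m` be the unique smooth
   solution of the advection diffusion equation (4.2) on `[0,2]`") — DISCHARGED,
   `Torus.exists_unique_isClassicalScalarTransportForcedOn_holds`
   (`PassiveScalarWellPosednessProofs.lean`).

The §§3–4 construction from 1 and 2 is `cheskidov_noAnomaly_family_of_acm`
(`CheskidovNoAnomalyAssembly.lean`). Composing: the fact follows from input 1 alone
(`cheskidov_noAnomaly_family_of_mixing_family`; and from the uniform-support reading
`alberti_crippa_mazzucato_quasi_self_similar`, `cheskidov_noAnomaly_family_of_mixing`), from the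
structural fact (`cheskidov_noAnomaly_family_of_acm_building_blocks`), and from the current
kinematic leaf (`cheskidov_noAnomaly_family_of_compatible_blocks`). What remains for
`cheskidov_noAnomaly_family_holds` is exactly `acm_compatible_blocks_holds` — the two smooth
time-dependent curves of ACM 2019, §8.1 (a)–(e), given in the source by Figures 7–9 (§8.9–8.11) —
the same leaf as for the sibling facts `cheskidov_total_dissipation_family`
(`CheskidovTotalDissipationOfBlocks.lean`) and `cheskidov_time_periodic_anomaly`
(`CheskidovTimePeriodicAnomaly.lean`).

## References

* A. Cheskidov, *Dissipation anomaly and anomalous dissipation in incompressible fluid flows*,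
  arXiv:2311.04182 (2023), Thm. 2.1, Thm. 3.1 (p. 10), §3 (3.2)–(3.13), Lemma 3.2 (3.16), §4
  pp. 12–14 ((4.2), (4.3), (4.19), (4.20)).
* E. Bruè, C. De Lellis, *Anomalous dissipation for the forced 3D Navier–Stokes equations*,
  Comm. Math. Phys. 400 (2023), §4.1, Thm. 4.1, Lemma 5.1.
* G. Alberti, G. Crippa, A. L. Mazzucato, *Exponential self-similar mixing by incompressible
  flows*, J. Amer. Math. Soc. 32 (2019), §6.2, §8.1, §8.4–8.8.
* N. V. Krylov, *Lectures on Elliptic and Parabolic Equations in Hölder Spaces* (1996), Thm. 9.2.3.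
-/

noncomputable section

namespace Literature.Analysis.FluidPDE

/-- **Cheskidov's no-anomaly family from the mixing family alone.** The named fact
`cheskidov_noAnomaly_family` (Cheskidov 2023, §§3–4 with the viscosities (4.19)) follows from the
single named fact `alberti_crippa_mazzucato_family` (Cheskidov 2023, Thm. 3.1 = Bruè–De Lellis
2023, Thm. 4.1, item (c) per level): the other input of the printed proof, parabolic
well-posedness of (4.2) on `[0,2] × T²`, is the proved
`Torus.exists_unique_isClassicalScalarTransportForcedOn_holds`, fed into
`cheskidov_noAnomaly_family_of_acm`. [cite: Cheskidov2023, Thm. 3.1, §4 (4.2)–(4.3) and (4.19)–(4.20)] -/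
theorem cheskidov_noAnomaly_family_of_mixing_family (h : alberti_crippa_mazzucato_family) :
    cheskidov_noAnomaly_family :=
  cheskidov_noAnomaly_family_of_acm h Torus.exists_unique_isClassicalScalarTransportForcedOn_holds

/-- **Deprecated** (2026-08-16) with its hypothesis, the mis-stated uniform-support reading of
Bruè–De Lellis Thm. 4.1 (c) (`alberti_crippa_mazzucato_quasi_self_similar`, one compact `K` for
all levels, deprecated in `QuasiSelfSimilarMixing.lean`): use
`cheskidov_noAnomaly_family_of_mixing_family`. *Content (unchanged):* the same composition starting
from that reading, through `cheskidov_noAnomaly_family_of_quasi_self_similar`.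
[cite: Cheskidov2023, Thm. 3.1 and §4] [cite: BrueDeLellisCMP2023, Thm. 4.1] -/
@[deprecated cheskidov_noAnomaly_family_of_mixing_family (since := "2026-08-16")]
theorem cheskidov_noAnomaly_family_of_mixing (h : alberti_crippa_mazzucato_quasi_self_similar) :
    cheskidov_noAnomaly_family :=
  cheskidov_noAnomaly_family_of_quasi_self_similar h
    Torus.exists_unique_isClassicalScalarTransportForcedOn_holds

/-- **Cheskidov's no-anomaly family from the structural building-block fact.** The fact follows
from `acm_building_blocks` (finitely many Alberti–Crippa–Mazzucato building blocks patching
smoothly with handover; ACM 2019, §8, as used in Bruè–De Lellis 2023, §4.1 and Thm. 4.1) through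
the scaling analysis `alberti_crippa_mazzucato_family_of_building_blocks`
(`QuasiSelfSimilarFamilyProofs`). [cite: Cheskidov2023, Thm. 3.1 and §4] [cite: BrueDeLellisCMP2023, Thm. 4.1] -/
theorem cheskidov_noAnomaly_family_of_acm_building_blocks (h : acm_building_blocks) :
    cheskidov_noAnomaly_family :=
  cheskidov_noAnomaly_family_of_mixing_family (alberti_crippa_mazzucato_family_of_building_blocks h)

/-- **Cheskidov's no-anomaly family from the kinematic leaf.** The fact follows from
`acm_compatible_blocks` (the compatible block system of the Peano snake: ACM 2019, §8.1 (a)–(e),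
§8.4 (a)–(c), §8.6; Bruè–De Lellis 2023, §4.1 (i)–(iv)) through
`acm_building_blocks_of_compatible_blocks` (`QuasiSelfSimilarCompatibleBlocksProofs`: labels,
patching and gluing of ACM §6.2, §8.6–8.8). This is the whole remaining debt of
`cheskidov_noAnomaly_family`, hence of the barrier `Cheskidov2023_thm21_noDissipationAnomaly`.
[cite: Cheskidov2023, Thm. 2.1, Thm. 3.1 and §4] [cite: AlbertiCrippaMazzucato2019, §8.1, §8.4, §8.6] -/
theorem cheskidov_noAnomaly_family_of_compatible_blocks (h : acm_compatible_blocks) :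
    cheskidov_noAnomaly_family :=
  cheskidov_noAnomaly_family_of_acm_building_blocks (acm_building_blocks_of_compatible_blocks h)

end Literature.Analysis.FluidPDE

end
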